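import Literature.Analysis.FluidPDE.TaoCascadeWaveletData
import HarnessLib

/-!
# Crux `PerpetualPump.AveragedTypeIBlowup` (stmt-NavierStokesRegularity-1835), line `Sketch`:
# stub `waveletSmallRadius` — Tao's wavelet data with thin Fourier balls of prescribed radius

T. Tao, *Finite time blowup for an averaged three-dimensional Navier–Stokes equation*, J. Amer.
Math. Soc. **29** (2016), 601–674 = arXiv:1402.0290v3, §4, p. 21: "Let `B_1, …, B_m` be balls in
the annulus `{ξ ∈ ℝ³ : 1 < |ξ| ≤ 1 + ε₀/2}`, chosen so that the `2m` balls
`B_1, …, B_m, -B_1, …, -B_m` are all disjoint. For each `i = 1, …, m`, let `ψ_i ∈ H¹⁰_df(ℝ³)` be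
Schwartz with Fourier transform real-valued and supported on `B_i ∪ -B_i`, normalised so that
`‖ψ_i‖_{L²(ℝ³)} = 1`."

This file proves the registered stub `stub_waveletSmallRadius` of the line's skeleton
(`Cruxes/AveragedTypeIBlowup/Lines/Sketch.lean`), verbatim: for every `ε₀ > 0` and every `r > 0`
there are wavelet data (the accepted hypothesis structure `CascadeWaveletData ε₀ 2` of
`Literature/Analysis/FluidPDE/TaoCascadeOperator.lean`) with two profiles whose Fourier balls have
radius `≤ r` and whose centres lie on the sphere `|ξ| = 1 + ε₀/4` (so that the heat rate
`4π²|ξ|²` of the mode `(i,n)` is pinched in `4π²(1+ε₀)^{2n}[(ρ₀-r)², (ρ₀+r)²]`, `ρ₀ = 1 + ε₀/4`).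

The proof is the construction of the accepted `nonempty_cascadeWaveletData`
(`Literature/Analysis/FluidPDE/TaoCascadeWaveletData.lean`), re-run with the common radius
additionally capped by `r`, and stated for every `m` (`exists_cascadeWaveletData_radius_le`):
centres `c_i = (1 + ε₀/4)(cos θ_i, sin θ_i, 0)`, `θ_i = (π/2)(i/m) ∈ [0, π/2)` (pairwise distinct,
never antipodal), a common radius `s ≤ r`, `s < ε₀/4`, smaller than half of every distance
`|c_i ∓ c_j|`, and the profiles of the accepted `exists_profile`. Their `Nonempty` statement hides
the radius and the norm of the centres, which is why the construction is repeated rather than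
invoked.

Nothing here closes the item (`--supports`); no statement of the route changes.

## References

* T. Tao, J. Amer. Math. Soc. 29 (2016), 601–674, arXiv:1402.0290v3, §4 p. 21.
  [`Tao2016AveragedNS`]
-/

noncomputable section

-- the summit namespace `…NavierStokesRegularity.NavierStokesRegularity…` is the tree convention
set_option linter.dupNamespace false

open MeasureTheory Set Filter Topology Metric
open scoped ENNReal RealInnerProductSpace Pointwise
open Literature.Analysis.FluidPDE Literature.Analysis.FluidPDE.Tao2016
open Literature.Analysis.FluidPDE.TaoCascade (quadTerm IsSymmetricCoeff IsCancellingCoeff shiftSet mem_shiftSet_iff)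

namespace Summit.NavierStokesRegularity.NavierStokesRegularity.Theorems.PerpetualPumpAveragedTypeIBlowup

/-- **Tao's wavelet data of §4 with thin balls**, every `m`: for `ε₀ > 0` and `r > 0` there are
wavelet data `CascadeWaveletData ε₀ m` all of whose balls have radius `≤ r` and all of whose
centres have norm exactly `1 + ε₀/4`. Centres `(1 + ε₀/4)(cos θ_i, sin θ_i, 0)`,
`θ_i = (π/2)(i/m)`, a common small radius `s ≤ r`, and the profiles of `exists_profile`
(the construction of `nonempty_cascadeWaveletData` with the radius capped by `r`).
[cite: Tao2016AveragedNS, §4 p. 21] -/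
theorem exists_cascadeWaveletData_radius_le {ε₀ : ℝ} (hε : 0 < ε₀) (m : ℕ) {r : ℝ} (hr : 0 < r) :
    ∃ 𝒟 : CascadeWaveletData ε₀ m, ∀ i : Fin m, 𝒟.radius i ≤ r ∧ ‖𝒟.center i‖ = 1 + ε₀ / 4 := by
  -- adapted from `Literature.Analysis.FluidPDE.Tao2016.nonempty_cascadeWaveletData`
  set ρ₀ : ℝ := 1 + ε₀ / 4 with hρ₀
  have hρ₀pos : 0 < ρ₀ := by positivity
  set θ : Fin m → ℝ := fun i => Real.pi / 2 * ((i : ℝ) / m) with hθ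
  have hθrange : ∀ i, 0 ≤ θ i ∧ θ i < Real.pi / 2 := by
    intro i
    have hm : (0 : ℝ) < m := by exact_mod_cast Fin.pos i
    have hi : ((i : ℕ) : ℝ) < m := by exact_mod_cast i.isLt
    refine ⟨by positivity, ?_⟩
    calc Real.pi / 2 * ((i : ℝ) / m) < Real.pi / 2 * 1 := by
          gcongr
          rwa [div_lt_one hm]
      _ = Real.pi / 2 := mul_one _
  set ξc : Fin m → EuclideanSpace ℝ (Fin 3) := fun i => ρ₀ • dirVec (θ i) with hξc
  have hnorm : ∀ i, ‖ξc i‖ = ρ₀ := fun i => by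
    rw [hξc, norm_smul, norm_dirVec, mul_one, Real.norm_of_nonneg hρ₀pos.le]
  have hξc_ne : ∀ i, ξc i ≠ 0 := fun i => by
    rw [← norm_ne_zero_iff, hnorm]
    exact hρ₀pos.ne'
  have hinner : ∀ i, ⟪e3, ξc i⟫ = 0 := fun i => by
    rw [hξc, inner_smul_right, inner_e3_dirVec, mul_zero]
  -- distinct, non-antipodal centres
  have hne1 : ∀ i j, i ≠ j → ξc i ≠ ξc j := by
    intro i j hij h
    apply hij
    have h' : dirVec (θ i) = dirVec (θ j) := smul_right_injective _ hρ₀pos.ne' h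
    have hcos : Real.cos (θ i) = Real.cos (θ j) := by
      rw [← dirVec_apply_zero, ← dirVec_apply_zero, h']
    have hθij : θ i = θ j := Real.injOn_cos ⟨(hθrange i).1, by linarith [(hθrange i).2, Real.pi_pos]⟩
      ⟨(hθrange j).1, by linarith [(hθrange j).2, Real.pi_pos]⟩ hcos
    have hm : (0 : ℝ) < m := by exact_mod_cast Fin.pos i
    have : ((i : ℕ) : ℝ) = (j : ℕ) := by
      have h2 := mul_left_cancel₀ (by positivity : Real.pi / 2 ≠ 0) hθij
      field_simp at h2
      exact h2
    exact Fin.ext (by exact_mod_cast this)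
  have hne2 : ∀ i j, ξc i ≠ -ξc j := by
    intro i j h
    have h0 := congrArg (fun v : EuclideanSpace ℝ (Fin 3) => v 0) h
    simp only [hξc, PiLp.smul_apply, PiLp.neg_apply, smul_eq_mul, dirVec_apply_zero] at h0
    have hci : 0 < Real.cos (θ i) := Real.cos_pos_of_mem_Ioo ⟨by linarith [(hθrange i).1, Real.pi_pos],
      (hθrange i).2⟩
    have hcj : 0 < Real.cos (θ j) := Real.cos_pos_of_mem_Ioo ⟨by linarith [(hθrange j).1, Real.pi_pos],
      (hθrange j).2⟩
    nlinarith
  -- a common small radius, capped by `r`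
  have hsmall : ∀ d : ℝ, 0 < d → ∀ᶠ s in 𝓝[>] (0 : ℝ), s + s < d := fun d hd =>
    ((eventually_lt_nhds (half_pos hd)).filter_mono nhdsWithin_le_nhds).mono fun s hs => by linarith
  have hcap : ∀ᶠ s in 𝓝[>] (0 : ℝ), s ≤ r :=
    ((eventually_lt_nhds hr).filter_mono nhdsWithin_le_nhds).mono fun s hs => hs.le
  have hev : ∀ᶠ s in 𝓝[>] (0 : ℝ), 0 < s ∧ s < ε₀ / 4 ∧
      (∀ i j, i ≠ j → s + s < dist (ξc i) (ξc j)) ∧ (∀ i j, s + s < dist (ξc i) (-ξc j)) ∧ s ≤ r := by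
    refine (eventually_mem_nhdsWithin).and ((((eventually_lt_nhds (by positivity : (0 : ℝ) < ε₀ / 4))).filter_mono
      nhdsWithin_le_nhds).and ((eventually_all.2 fun i => eventually_all.2 fun j => ?_).and
        ((eventually_all.2 fun i => eventually_all.2 fun j => hsmall _ (dist_pos.2 (hne2 i j))).and hcap)))
    by_cases hij : i = j
    · exact Eventually.of_forall fun s h => absurd hij h
    · exact (hsmall _ (dist_pos.2 (hne1 i j hij))).mono fun s hs _ => hs
  obtain ⟨s, hs0, hs1, hs2, hs3, hs4⟩ := hev.exists
  -- the profiles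
  choose ψ hψ using fun i => exists_profile (hξc_ne i) e3_ne_zero (hinner i) hs0
  refine ⟨{ center := ξc
            radius := fun _ => s
            ψ := ψ
            ball_subset := fun i ξ hξ => ?_
            disjoint := fun i j hij => ball_disjoint_ball (hs2 i j hij).le
            disjoint_neg := fun i j => ?_
            isDivFree := fun i => (hψ i).1
            fourier_im := fun i => (hψ i).2.1
            fourier_support := fun i => (hψ i).2.2.1
            norm_eq_one := fun i => (hψ i).2.2.2 }, fun i => ⟨hs4, hnorm i⟩⟩
  · rw [mem_ball] at hξ
    have h1 : ‖ξ‖ ≤ ‖ξc i‖ + dist ξ (ξc i) := norm_le_norm_add_const_of_dist_le le_rfl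
    have h2 : ‖ξc i‖ - ‖ξ‖ ≤ dist ξ (ξc i) := by
      rw [dist_comm, dist_eq_norm]
      exact norm_sub_norm_le _ _
    rw [hnorm] at h1 h2
    constructor
    · linarith
    · linarith
  · rw [neg_ball]
    exact ball_disjoint_ball (hs3 i j).le

/-- **Stub `waveletSmallRadius`** (L1a) of line `Sketch`. Wavelet data with two profiles whose
Fourier balls have a prescribed small radius `≤ r` and centres on the sphere `|ξ| = 1 + ε₀/4` (so
the heat rates of the mode `(i,n)` lie in `4π²(1+ε₀)^{2n}[(ρ₀-r)², (ρ₀+r)²]`, `ρ₀ = 1+ε₀/4`): the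
construction of `nonempty_cascadeWaveletData` with the common radius shrunk below `r`
(`exists_cascadeWaveletData_radius_le` at `m = 2`). [cite: Tao2016AveragedNS, §4 p. 21] -/
theorem stub_waveletSmallRadius :
    ∀ {ε₀ : ℝ}, 0 < ε₀ → ∀ r : ℝ, 0 < r →
      ∃ 𝒟 : CascadeWaveletData ε₀ 2, ∀ i : Fin 2, 𝒟.radius i ≤ r ∧ ‖𝒟.center i‖ = 1 + ε₀ / 4 :=
  fun hε _ hr => exists_cascadeWaveletData_radius_le hε 2 hr

end Summit.NavierStokesRegularity.NavierStokesRegularity.Theorems.PerpetualPumpAveragedTypeIBlowup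

end
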